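import Literature.MathematicalPhysics.QuantumFieldTheory.Balaban1983to89.B7Prop3GeneralLinearPdevRec
import Literature.MathematicalPhysics.QuantumFieldTheory.Balaban1983to89.B7Prop3PureGaugeRec
import Literature.MathematicalPhysics.QuantumFieldTheory.Balaban1983to89.B7Prop4GaugeInductionRec
import Literature.MathematicalPhysics.QuantumFieldTheory.Balaban1983to89.B7Prop2Rec
import Literature.MathematicalPhysics.QuantumFieldTheory.Balaban1983to89.B7Prop4GeneralLevels

/-!
# `Balaban1983to89.B7Prop4GeneralLevelsRec` — [Balaban1985Averaging] PROPOSITION 4 (127)–(133) AT A GENERAL REGULAR BACKGROUND, k-UNIFORM, FOR THE RECORD's AVERAGING STRUCTURE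
# ([Balaban1987RG1] (0.4)) — conditional on Proposition 3's remainder bound (123) exactly as the engine's `B7Prop4GeneralLevels.prop4_general_of_prop3`, with the carried gauge letter

statement-level skeleton of published theorems with citation tags; proofs where landed; nothing here is a claim about the Yang–Mills mass gap

CITATION HEADER (lean-in-tree rule).  Cell `pub-ymgap`, seat `pub-ymgap-dag-n05-e` g36 (N05-REC LEAD PEN); item R1 ([3] layer): the record twin of `B7Prop4GeneralLevels` (§2 `level_regularity`,
§4 `prop4_general_of_prop3`) under road (A′).  `--kind definition --supports stmt-QuantumFields-20541` (K0⁷; count-neutral; three constant `def`s `cZ`, `gZ`, `KZ` + theorems).  Sources READ: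
[3] = [Balaban1985Averaging] pp. 37–38 (127)–(133), p. 36 (122)–(126), p. 31 (93) (`paper:balaban1985-cmp98-averaging`); [I] = [Balaban1987RG1] (0.4) p. 253.  REUSED BY NAME:
`B7Prop4GaugeInductionRec.prop4_gauge_induction` (the abstract k-uniform induction with the carried letter), `B7Prop3GeneralLinearPdevRec.norm_QhatZ_le_of_pdev` ((126) for `Q̂`),
`B7Prop3GaugeCarryRec` (`QhatZ`, `lamZ`, `dcovZ`, `norm_lamZ_le_length`), `B7Prop3PureGaugeRec` (`dcovF`, `QhatZ_dcovF_add` — the pure-gauge identity), `B7Prop2Rec` (Prop. 2 for the record: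
`prop2_explicitZ_lt_two`, `avgIterZ_mem`, `AvgClosedZ`, `C0Z`), the engine's `B7Prop4GeneralLevels.levelFactors_prod_le_exp` (the k-uniform constant).

WHAT IS PROVED (sorry-free).  §1 the constants `cZ d = 16(d+1)(d+2)²` ((126) for `Q̂`), `gZ d L = 2dL` (the trivial bound of the carried letter), `KZ d L = 2(1 + 2gZ)`; ★`level_regularityZ` — every
level background `Ū₀ʲ = avgIterZ L U₀ j`, `j ≤ k`, has `pdev < 2α₀(L^j∕L^k)²` and is `G`-valued (Prop. 2 for the record); §2 bookkeeping: `dcovF_succ_eq_dcovZ` (the covariant coarse derivative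
along `V̄_j(c)` IS the fine covariant derivative at level `j+1`, by `avgIterZ_succ`), `WZ_lt_one_of_pdev` (the small-loop guard of (120) at every level), `QhatZ_sub`, `dcovF_sub`, `norm_dcovF_le`,
`norm_rlamZ_le`; §3 ★★★ `prop4_generalZ_of_prop3` — **PROPOSITION 4 FOR THE RECORD, k-UNIFORM**: given Prop. 3's remainder bound (123) `‖Q(V₀, A, c) − L(Q(V₀)A)_c‖ ≤ C₁L²|A|²` as a
HYPOTHESIS (shape of the engine's `h3rem`; discharged by the sequel `B7Eq123GeneralRec`), for `U₀` `G`-valued with `pdev U₀ < α₀L^{−2k}` and an initial field `|B| ≤ b`, at every level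
`j ≤ k`: (126)_rec `‖L^jηQ_j(U₀)B‖ ≤ (1+2gZ)e^{4cZ·α₀}·L^jb`, (130)_rec `‖Q_j(U₀, ηB) − L^jηQ_j(U₀)B‖ ≤ (1+2gZ)·2C₁KZ²·e^{4cZ·α₀}·(L^jb)²`, (131)_rec `‖Q_j(U₀, ηB)‖ ≤ KZ·L^jb` — print's
(128)∕(130)∕(131) with constants depending on `d, L` only, UNIFORM IN `k`; odd `L = 2s+1 ≥ 3` (centred blocks), `2α₀ ≤ 1∕(2d(d+2)L²)`, `e^{4cZα₀}(1 + 2C₁KZ²·L^kb) ≤ 2`, `KZ·L^jb ≤ c₃`.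
HONEST SCOPE.  The record's Prop. 4 modulo Prop. 3's (123) (a displayed hypothesis, as in the engine lineage); the carried gauge letter is bounded only trivially here (its curvature bound
`norm_lamZ_le` serves (1.56)–(1.57), not this induction); nothing of [3]∕[6]∕[I] asserted; `HThm4Rec` UNDISCHARGED; N05 discharged of record untouched; N07 not claimable; counts unmoved
(typed 28∕28 · discharged 8∕28); one finite 𝕋⁴ programme at fixed ε — nothing continuum ∕ ℝ⁴ ∕ OS ∕ mass gap ∕ Clay.  Three constant `def`s, no `instance`, no `notation`, no `sorry`.
-/

set_option autoImplicit false

noncomputable section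

open scoped BigOperators
open Finset

namespace Literature.MathematicalPhysics.QuantumFieldTheory.Balaban1983to89.B7Prop4GeneralLevelsRec

open B7Prop1Explicit hiding Site
open B7Prop1Explicit renaming Site → SiteZ
open B7Prop2Explicit (pdev le_pdev pdev_nonneg rescale c2')
open B7Prop3GeneralRotated
open B7Eq78Linearization (conjR conjR_apply conjR_sub conjR_smul)
open B7Eq170Flat (bmean norm_bmean_le)
open BlockAveragingZd (IdxZ WZ bavgZ avgIterZ avgIterZ_succ offZ)
open B8Lemma1NonAbelianRecLoops (omegaC)
open B7SectEFLinearisationRec (QcovZ linQcovZ logCovIterZ linCovIterZ logCovIterZ_succ linCovIterZ_succ rlamZ)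
open B7Prop2Rec (AvgClosedZ C0Z C0Z_pos avgIterZ_mem prop2_explicitZ_lt_two)
open B7Prop3GaugeCarryRec (lamZ dcovZ QhatZ dcovZ_apply QhatZ_def linQcovZ_eq_QhatZ_add_dcovZ QhatZ_add QhatZ_smul lamZ_sub norm_lamZ_le_length)
open B7Prop3PureGaugeRec (dcovF dcovF_apply QhatZ_dcovF_add rlamZ_eq)
open B7Prop3GeneralLinearPdevRec (norm_QhatZ_le_of_pdev WZ_regular_of_plaquettes omegaC_le)
open B7Prop4GaugeInductionRec (prop4_gauge_induction one_le_prod_one_add prod_one_add_mono)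
open B7Prop4GeneralLevels (levelFactors_prod_le_exp)

variable {d : ℕ}

variable {𝔸 : Type*} [NormedRing 𝔸] [NormedAlgebra ℂ 𝔸] [NormOneClass 𝔸] [CompleteSpace 𝔸]
variable (L : ℕ)

/-! ## §1 Constants, and the level backgrounds are regular (Proposition 2 for the record at every level) -/

/-- `cZ d = 16(d+1)(d+2)²` — the `O(1)` of (126) for the gauge-corrected linear part of the record (`B7Prop3GeneralLinearPdevRec.norm_QhatZ_le_of_pdev`). [cite: Balaban1985Averaging, (126) p.36] -/
def cZ (d : ℕ) : ℝ := 16 * ((d : ℝ) + 1) * ((d : ℝ) + 2) ^ 2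

/-- `gZ d L = 2dL` — the trivial (length) bound of the carried gauge letter relative to `sup|A|` (`norm_lamZ_le_length`). [cite: Balaban1985Averaging, (125)–(126) p.36; Balaban1987RG1, (0.3) p.252] -/
def gZ (d L : ℕ) : ℝ := 2 * ((d : ℝ) * L)

/-- `KZ d L = 2(1 + 2gZ)` — the record's constant in (131) (print's `2`). [cite: Balaban1985Averaging, (131) p.38] -/
def KZ (d L : ℕ) : ℝ := 2 * (1 + 2 * gZ d L)

omit [NormedAlgebra ℂ 𝔸] [NormOneClass 𝔸] [CompleteSpace 𝔸] in
/-- `0 ≤ cZ`. [cite: Balaban1985Averaging, (126) p.36 (bookkeeping)] -/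
theorem cZ_nonneg (d : ℕ) : 0 ≤ cZ d := by unfold cZ; positivity

omit [NormedAlgebra ℂ 𝔸] [NormOneClass 𝔸] [CompleteSpace 𝔸] in
/-- `0 ≤ gZ`. [cite: Balaban1985Averaging, (126) p.36 (bookkeeping)] -/
theorem gZ_nonneg (d L : ℕ) : 0 ≤ gZ d L := by unfold gZ; positivity

/-- ★ **THE LEVEL BACKGROUNDS ARE REGULAR** — p. 37, after (127): «the configurations Ū₀ʲ for j < k satisfy the assumptions of Proposition 3 for V₀ = Ū₀ʲ» — FOR THE RECORD: from
`B7Prop2Rec` (Prop. 2 for the (0.4) average), for `U₀` `G`-valued with `pdev U₀ < α₀·L^{−2k}`, `C₀α₀ ≤ 1∕3`, `2α₀ ≤ c₂′`, every `Ū₀ʲ = avgIterZ L U₀ j`, `j ≤ k`, has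
`pdev Ū₀ʲ < 2α₀(L^j∕L^k)²` and is `G`-valued. [cite: Balaban1985Averaging, p.37 (after (127)), Prop. 2 (54) p.26; Balaban1987RG1, (0.4) p.253] -/
theorem level_regularityZ (hL : 2 ≤ L) {G : Subgroup 𝔸ˣ} (hG : AvgClosedZ d L G) (k : ℕ)
    (U₀ : SiteZ d → Fin d → 𝔸ˣ) (hU₀ : ∀ x κ, U₀ x κ ∈ G) {α₀ : ℝ} (hα : 0 < α₀)
    (hα3 : C0Z d * α₀ ≤ 1 / 3) (hα2 : 2 * α₀ ≤ c2' d L) (h52 : pdev U₀ < α₀ * (((L : ℝ) ^ k)⁻¹) ^ 2) :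
    ∀ j ≤ k, pdev (avgIterZ L U₀ j) < 2 * (α₀ * ((L : ℝ) ^ j * ((L : ℝ) ^ k)⁻¹) ^ 2) ∧
      ∀ x κ, avgIterZ L U₀ j x κ ∈ G := by
  intro j hj
  have hL1 : (1 : ℝ) ≤ L := by exact_mod_cast le_trans (by norm_num) hL
  have hLk : (0 : ℝ) < (L : ℝ) ^ k := by positivity
  set α' : ℝ := α₀ * ((L : ℝ) ^ j * ((L : ℝ) ^ k)⁻¹) ^ 2 with hα'
  have hratio : (L : ℝ) ^ j * ((L : ℝ) ^ k)⁻¹ ≤ 1 := by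
    rw [mul_inv_le_iff₀ hLk, one_mul]; exact pow_le_pow_right₀ hL1 hj
  have hratio0 : 0 ≤ (L : ℝ) ^ j * ((L : ℝ) ^ k)⁻¹ := by positivity
  have hα'le : α' ≤ α₀ := by
    have h1 : ((L : ℝ) ^ j * ((L : ℝ) ^ k)⁻¹) ^ 2 ≤ 1 := by
      rw [← one_pow 2]; exact pow_le_pow_left₀ hratio0 hratio 2
    calc α' = α₀ * ((L : ℝ) ^ j * ((L : ℝ) ^ k)⁻¹) ^ 2 := rfl
      _ ≤ α₀ * 1 := mul_le_mul_of_nonneg_left h1 hα.le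
      _ = α₀ := mul_one _
  have hα'pos : 0 < α' := by positivity
  have hα3' : C0Z d * α' ≤ 1 / 3 := (mul_le_mul_of_nonneg_left hα'le (C0Z_pos d).le).trans hα3
  have hα2' : 2 * α' ≤ c2' d L := by linarith
  have h52' : pdev U₀ < α' * (((L : ℝ) ^ j)⁻¹) ^ 2 := by
    have heq : α' * (((L : ℝ) ^ j)⁻¹) ^ 2 = α₀ * (((L : ℝ) ^ k)⁻¹) ^ 2 := by
      rw [hα']; field_simp
    rwa [heq]
  exact ⟨prop2_explicitZ_lt_two L hL hG j U₀ hU₀ hα'pos hα3' hα2' h52',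
    avgIterZ_mem L hL hG j U₀ hU₀ hα'pos hα3' hα2' h52' j le_rfl⟩

/-! ## §2 Bookkeeping: the coarse derivative along `V̄_j(c)` is the fine derivative at level `j+1`; the small-loop guard at every level; norms -/

section Bookkeeping

omit [NormOneClass 𝔸] in
/-- **`(d_{V̄_j}f)(⟨Lz, Lz + Le_κ⟩) = (d_{Ū₀^{j+1}}(f∘L·))(z, κ)`** — the covariant coarse derivative along the averaged bond IS the fine covariant derivative at the next level, read on the unit
lattice after rescaling (`avgIterZ_succ`: `Ū₀^{j+1}(z, κ) = V̄_j(Lz, κ)`). [cite: Balaban1985Averaging, (43) p.24, (93) p.31] -/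
theorem dcovF_succ_eq_dcovZ (U₀ : SiteZ d → Fin d → 𝔸ˣ) (j : ℕ) (f : SiteZ d → 𝔸) (z : SiteZ d) (κ : Fin d) :
    dcovF (avgIterZ L U₀ (j + 1)) (fun w => f ((L : ℤ) • w)) z κ = dcovZ L (avgIterZ L U₀ j) f ((L : ℤ) • z) κ := by
  rw [dcovF_apply, dcovZ_apply, avgIterZ_succ, smul_add]
  rfl

omit [NormedAlgebra ℂ 𝔸] [CompleteSpace 𝔸] in
/-- **The small-loop guard of (120) at a regular background**: `pdev V₀ ≤ β`, `2d(d+2)L²β ≤ 1`, `L = 2s+1` ⇒ every (0.4) loop variable is within `1∕8 < 1` of `1`.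
[cite: Balaban1985Averaging, (120) p.35, (44) p.24; Balaban1987RG1, (0.4) p.253] -/
theorem WZ_lt_one_of_pdev {s : ℕ} (hLs : L = 2 * s + 1) {V₀ : SiteZ d → Fin d → 𝔸ˣ} (hV₀ : ∀ x κ, V₀ x κ ∈ U1 𝔸)
    {β : ℝ} (hβ : pdev V₀ ≤ β) (hsmall : 2 * (d : ℝ) * (d + 2) * (L : ℝ) ^ 2 * β ≤ 1) (q : SiteZ d) (κ : Fin d) (i : IdxZ d L) :
    ‖((WZ L V₀ q κ i : 𝔸ˣ) : 𝔸) - 1‖ < 1 := by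
  have hβ0 : 0 ≤ β := (pdev_nonneg V₀).trans hβ
  have h44 : ∀ (x : SiteZ d) (κ' μ : Fin d), κ' ≠ μ → ‖((hol V₀ x (plaqWord κ' μ) : 𝔸ˣ) : 𝔸) - 1‖ ≤ β :=
    fun x κ' μ _ => (le_pdev hV₀ x κ' μ).trans hβ
  have h1 := WZ_regular_of_plaquettes L hV₀ hβ0 h44 hLs q κ i
  have h2 := (omegaC_le (d := d) L hβ0 hLs).1
  have hd0 : (0 : ℝ) ≤ d := by positivity
  have : (d : ℝ) * (d + 2) * (L : ℝ) ^ 2 / 4 * β ≤ 1 / 8 := by nlinarith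
  linarith

/-- `Q̂(V₀)` is subtractive in `A` (under the small-loop guard). [cite: Balaban1985Averaging, (122) p.36] -/
theorem QhatZ_sub (V₀ : SiteZ d → Fin d → 𝔸ˣ) (A A' : SiteZ d → Fin d → 𝔸) (q : SiteZ d) (κ : Fin d)
    (hW : ∀ i : IdxZ d L, ‖((WZ L V₀ q κ i : 𝔸ˣ) : 𝔸) - 1‖ < 1) :
    QhatZ L V₀ (A - A') q κ = QhatZ L V₀ A q κ - QhatZ L V₀ A' q κ := by
  have hneg : -A' = (-1 : ℂ) • A' := by simp
  rw [sub_eq_add_neg, QhatZ_add L V₀ A (-A') q κ hW, hneg, QhatZ_smul L V₀ (-1) A' q κ hW]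
  simp [sub_eq_add_neg]

omit [NormedAlgebra ℂ 𝔸] [NormOneClass 𝔸] [CompleteSpace 𝔸] in
/-- `d_{V₀}` is subtractive. [cite: Balaban1985Averaging, (55)–(56) p.27] -/
theorem dcovF_sub (V₀ : SiteZ d → Fin d → 𝔸ˣ) (θ θ' : SiteZ d → 𝔸) : dcovF V₀ (θ - θ') = dcovF V₀ θ - dcovF V₀ θ' := by
  funext x ν
  simp only [dcovF_apply, Pi.sub_apply, conjR_sub]
  abel

omit [NormedAlgebra ℂ 𝔸] [CompleteSpace 𝔸] in
/-- `‖(d_{V₀}θ)(b)‖ ≤ 2·sup|θ|` (`V₀ ∈ U1`). [cite: Balaban1985Averaging, (56)–(57) p.27] -/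
theorem norm_dcovF_le {V₀ : SiteZ d → Fin d → 𝔸ˣ} (hV₀ : ∀ x κ, V₀ x κ ∈ U1 𝔸) {θ : SiteZ d → 𝔸} {m : ℝ} (hθ : ∀ z, ‖θ z‖ ≤ m)
    (x : SiteZ d) (ν : Fin d) : ‖dcovF V₀ θ x ν‖ ≤ 2 * m := by
  rw [dcovF_apply]
  refine (norm_sub_le _ _).trans ?_
  have := norm_conjR_le (hV₀ x ν) (θ (x + e ν))
  linarith [hθ x, hθ (x + e ν)]

omit [NormOneClass 𝔸] [CompleteSpace 𝔸] in
/-- `‖(R̄θ)(y)‖ ≤ sup|θ|` — the rotated block mean is a sup-norm contraction (`V₀ ∈ U1`; the engine's `norm_rlam_le`). [cite: Balaban1985Averaging, (78) p.30, (211) p.49] -/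
theorem norm_rlamZ_le [NormOneClass 𝔸] (hL : 1 ≤ L) {V₀ : SiteZ d → Fin d → 𝔸ˣ} (hV₀ : ∀ x κ, V₀ x κ ∈ U1 𝔸) {θ : SiteZ d → 𝔸} {m : ℝ}
    (hθ : ∀ z, ‖θ z‖ ≤ m) (y : SiteZ d) : ‖rlamZ L V₀ θ y‖ ≤ m := by
  rw [rlamZ_eq]
  have := norm_bmean_le (d := d) hL (f := fun r => conjR (hol V₀ y (treeWord (offZ L r))) (θ (y + offZ L r))) (M := m)
    fun r => (norm_conjR_le (hol_mem hV₀ _ _) _).trans (hθ _)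
  rwa [B7Eq170Flat.bmean_apply] at this

end Bookkeeping

/-! ## §3 Proposition 4 for the record, k-uniform, conditional on Proposition 3's remainder bound -/

section Prop4

/-- ★★★ **PROPOSITION 4 AT A GENERAL REGULAR BACKGROUND, k-UNIFORM, FOR THE RECORD's AVERAGING STRUCTURE — CONDITIONAL ON PROPOSITION 3's (123).**  HYPOTHESIS `h3rem`: at every
`G`-valued background with `pdev V₀ < β ≤ βmax ≤ 1∕(2d(d+2)L²)` and field with `sup‖A‖ ≤ a ≤ c₃`, `‖Q(V₀, A, c) − L(Q(V₀)A)_c‖ ≤ C₁L²a²` (the engine binder's shape; the sequel `B7Eq123GeneralRec` discharges it).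
Everything else is discharged HERE for the record: (126) for `Q̂` (`B7Prop3GeneralLinearPdevRec`), the trivial bound `2dL·|A|` of the carried letter, the pure-gauge identity
(`B7Prop3PureGaugeRec`), the level regularity (Prop. 2 for the record), the k-uniform constant (`levelFactors_prod_le_exp`), and the abstract induction `prop4_gauge_induction`.
CONCLUSION: for `U₀` `G`-valued (`G` averaging-closed for the record) with `pdev U₀ < α₀·L^{−2k}`, `C₀α₀ ≤ 1∕3`, `2α₀ ≤ c₂′`, `2α₀ ≤ βmax`, an initial field `sup‖B‖ ≤ b` with
`e^{4cZα₀}(1 + 2C₁KZ²·L^kb) ≤ 2` and `KZ·L^jb ≤ c₃` (`j < k`), odd `L = 2s + 1 ≥ 3`: at EVERY `j ≤ k`, (126)_rec `‖L^jηQ_j(U₀)B‖ ≤ (1+2gZ)·e^{4cZα₀}·L^jb`, (130)_rec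
`‖Q_j(U₀,ηB) − L^jηQ_j(U₀)B‖ ≤ (1+2gZ)·2C₁KZ²·e^{4cZα₀}·(L^jb)²`, (131)_rec `‖Q_j(U₀,ηB)‖ ≤ KZ·L^jb` — constants in `d, L` only, UNIFORM IN `k`.
[cite: Balaban1985Averaging, (127)–(133) pp.37–38, (126) p.36, (93) p.31; Balaban1987RG1, (0.4) p.253] -/
theorem prop4_generalZ_of_prop3 {s : ℕ} (hLs : L = 2 * s + 1) (hs : 1 ≤ s) {G : Subgroup 𝔸ˣ} (hG : AvgClosedZ d L G)
    {C₁ c₃ βmax : ℝ} (hC₁ : 0 ≤ C₁) (hβmaxle : βmax ≤ 1 / (2 * (d : ℝ) * (d + 2) * (L : ℝ) ^ 2))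
    (h3rem : ∀ (V₀ : SiteZ d → Fin d → 𝔸ˣ) (β : ℝ), (∀ x κ, V₀ x κ ∈ G) → 0 ≤ β → pdev V₀ < β →
      β ≤ βmax → ∀ (A : SiteZ d → Fin d → 𝔸) (a : ℝ), 0 ≤ a → a ≤ c₃ → (∀ x κ, ‖A x κ‖ ≤ a) →
      ∀ q κ, ‖QcovZ L V₀ A q κ - linQcovZ L V₀ A q κ‖ ≤ C₁ * (L : ℝ) ^ 2 * a ^ 2)
    (k : ℕ) (U₀ : SiteZ d → Fin d → 𝔸ˣ) (hU₀ : ∀ x κ, U₀ x κ ∈ G) {α₀ : ℝ} (hα : 0 < α₀)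
    (hα3 : C0Z d * α₀ ≤ 1 / 3) (hα2 : 2 * α₀ ≤ c2' d L) (h52 : pdev U₀ < α₀ * (((L : ℝ) ^ k)⁻¹) ^ 2)
    (hβmax : 2 * α₀ ≤ βmax)
    (B : SiteZ d → Fin d → 𝔸) {b : ℝ} (hb : 0 ≤ b) (hB : ∀ x κ, ‖B x κ‖ ≤ b)
    (hsmall : Real.exp (4 * cZ d * α₀) * (1 + 2 * C₁ * (KZ d L) ^ 2 * ((L : ℝ) ^ k * b)) ≤ 2)
    (hc₃ : ∀ j < k, KZ d L * ((L : ℝ) ^ j * b) ≤ c₃) :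
    ∀ j ≤ k,
      (∀ z κ, ‖linCovIterZ L U₀ B j z κ‖ ≤ (1 + 2 * gZ d L) * Real.exp (4 * cZ d * α₀) * ((L : ℝ) ^ j * b)) ∧
      (∀ z κ, ‖logCovIterZ L U₀ B j z κ - linCovIterZ L U₀ B j z κ‖
        ≤ (1 + 2 * gZ d L) * (2 * C₁ * (KZ d L) ^ 2) * Real.exp (4 * cZ d * α₀) * ((L : ℝ) ^ j * b) ^ 2) ∧
      (∀ z κ, ‖logCovIterZ L U₀ B j z κ‖ ≤ KZ d L * ((L : ℝ) ^ j * b)) := by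
  -- numerics of L, d
  have hL3 : 3 ≤ L := by omega
  have hL2 : 2 ≤ L := by omega
  have hL1 : 1 ≤ L := by omega
  have hLr : (2 : ℝ) ≤ L := by exact_mod_cast hL2
  have hd1 : 1 ≤ d ∨ d = 0 := by omega
  have hGU : G ≤ U1 𝔸 := hG.le_U1
  -- the level data
  set V : ℕ → SiteZ d → Fin d → 𝔸ˣ := fun j => avgIterZ L U₀ j with hV
  set βf : ℕ → ℝ := fun j => 2 * (α₀ * ((L : ℝ) ^ j * ((L : ℝ) ^ k)⁻¹) ^ 2) with hβf
  set κf : ℕ → ℝ := fun j => cZ d * (L : ℝ) ^ 2 * βf j with hκf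
  have hreg := level_regularityZ L hL2 hG k U₀ hU₀ hα hα3 hα2 h52
  have hβ0 : ∀ j, 0 ≤ βf j := fun j => by rw [hβf]; positivity
  have hκ0 : ∀ j, 0 ≤ κf j := fun j => by rw [hκf]; exact mul_nonneg (mul_nonneg (cZ_nonneg d) (by positivity)) (hβ0 j)
  have hβle : ∀ j ≤ k, βf j ≤ βmax := by
    intro j hj
    have hL1r : (1 : ℝ) ≤ L := by linarith
    have hLk : (0 : ℝ) < (L : ℝ) ^ k := by positivity
    have hratio : (L : ℝ) ^ j * ((L : ℝ) ^ k)⁻¹ ≤ 1 := by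
      rw [mul_inv_le_iff₀ hLk, one_mul]; exact pow_le_pow_right₀ hL1r hj
    have h1 : ((L : ℝ) ^ j * ((L : ℝ) ^ k)⁻¹) ^ 2 ≤ 1 := by
      rw [← one_pow 2]; exact pow_le_pow_left₀ (by positivity) hratio 2
    have : βf j ≤ 2 * α₀ := by rw [hβf]; nlinarith [mul_le_mul_of_nonneg_left h1 hα.le]
    exact this.trans hβmax
  have hsmallβ : ∀ j ≤ k, 2 * (d : ℝ) * (d + 2) * (L : ℝ) ^ 2 * βf j ≤ 1 := by
    intro j hj
    have hX : 0 ≤ 2 * (d : ℝ) * (d + 2) * (L : ℝ) ^ 2 := by positivity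
    by_cases hX0 : 2 * (d : ℝ) * (d + 2) * (L : ℝ) ^ 2 = 0
    · rw [hX0, zero_mul]; norm_num
    have hXp : 0 < 2 * (d : ℝ) * (d + 2) * (L : ℝ) ^ 2 := lt_of_le_of_ne hX (Ne.symm hX0)
    have := mul_le_mul_of_nonneg_left ((hβle j hj).trans hβmaxle) hX
    rwa [one_div, mul_inv_cancel₀ hXp.ne'] at this
  have hV1 : ∀ j ≤ k, ∀ x κ, V j x κ ∈ U1 𝔸 := fun j hj x κ => hGU ((hreg j hj).2 x κ)
  have hpdev : ∀ j ≤ k, pdev (V j) ≤ βf j := fun j hj => (hreg j hj).1.le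
  have hW : ∀ j ≤ k, ∀ (q : SiteZ d) (κ : Fin d) (i : IdxZ d L), ‖((WZ L (V j) q κ i : 𝔸ˣ) : 𝔸) - 1‖ < 1 :=
    fun j hj q κ i => WZ_lt_one_of_pdev L hLs (hV1 j hj) (hpdev j hj) (hsmallβ j hj) q κ i
  -- the k-uniform constant
  have hP : ∏ i ∈ range k, (1 + κf i) ≤ Real.exp (4 * cZ d * α₀) := by
    have := levelFactors_prod_le_exp (c := cZ d) hLr (cZ_nonneg d) hα.le k
    simpa [hκf, hβf] using this
  -- the abstract induction, instantiated
  have hind := prop4_gauge_induction (σ := SiteZ d) (τ := Fin d) (𝔸 := 𝔸) (c₃ := c₃) (P := Real.exp (4 * cZ d * α₀))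
    (g := gZ d L) hLr hC₁ (gZ_nonneg d L) (k := k) κf hκ0
    (fun j A z κ => QcovZ L (V j) A ((L : ℤ) • z) κ)
    (fun j A z κ => QhatZ L (V j) A ((L : ℤ) • z) κ)
    (fun j A z => lamZ L (V j) A ((L : ℤ) • z))
    (fun j θ => dcovF (V j) θ)
    (fun j θ z => rlamZ L (V j) θ ((L : ℤ) • z))
    -- hQsub
    (fun j hj A A' => funext fun z => funext fun κ => QhatZ_sub L (V j) A A' _ κ (hW j hj.le _ κ))
    -- hGsub
    (fun j _ A A' => funext fun z => lamZ_sub L (V j) A A' _)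
    -- hDsub
    (fun j _ θ θ' => dcovF_sub (V j) θ θ')
    -- hgauge: the pure-gauge identity at level j, read at level j+1
    (fun j hj θ => funext fun z => funext fun κ => by
      have hjk : j + 1 ≤ k := hj
      show QhatZ L (V j) (dcovF (V j) θ) ((L : ℤ) • z) κ + dcovF (V (j + 1)) (fun w => lamZ L (V j) (dcovF (V j) θ) ((L : ℤ) • w)) z κ
        = dcovF (V (j + 1)) (fun w => rlamZ L (V j) θ ((L : ℤ) • w)) z κ
      rw [hV, dcovF_succ_eq_dcovZ, dcovF_succ_eq_dcovZ]
      exact QhatZ_dcovF_add L hL1 _ θ _ κ (hW j hj.le _ κ))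
    -- hrem = Prop. 3's (123) at the level background
    (fun j hj A r hr hrc hA z κ => by
      have h := h3rem (V j) (βf j) (hreg j hj.le).2 (hβ0 j) (hreg j hj.le).1 (hβle j hj.le) A r hr hrc hA ((L : ℤ) • z) κ
      have e : QhatZ L (V j) A ((L : ℤ) • z) κ + dcovF (V (j + 1)) (fun w => lamZ L (V j) A ((L : ℤ) • w)) z κ = linQcovZ L (V j) A ((L : ℤ) • z) κ := by
        rw [hV, dcovF_succ_eq_dcovZ, ← linQcovZ_eq_QhatZ_add_dcovZ]
      show ‖QcovZ L (V j) A ((L : ℤ) • z) κ - (QhatZ L (V j) A ((L : ℤ) • z) κ + dcovF (V (j + 1)) (fun w => lamZ L (V j) A ((L : ℤ) • w)) z κ)‖ ≤ _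
      rw [e]
      exact h)
    -- hlin = (126) for Q̂ at the level background
    (fun j hj A r hr hA z κ => by
      have h := norm_QhatZ_le_of_pdev L (hV1 j hj.le) hr hA hLs (hpdev j hj.le) (hsmallβ j hj.le) ((L : ℤ) • z) κ
      have e : (L : ℝ) * (1 + 16 * ((d : ℝ) + 1) * ((d : ℝ) + 2) ^ 2 * (L : ℝ) ^ 2 * βf j) * r = L * (1 + κf j) * r := by
        rw [hκf, cZ]
      rw [← e]; exact h)
    -- hGn = the trivial bound of the carried letter
    (fun j hj A r hr hA z => by
      show ‖lamZ L (V j) A ((L : ℤ) • z)‖ ≤ gZ d L * r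
      rw [gZ]
      exact norm_lamZ_le_length L hL1 (hV1 j hj.le) hr hA _)
    -- hDn, hMn
    (fun j hj θ m _ hθ x ν => norm_dcovF_le (hV1 j hj) hθ x ν)
    (fun j hj θ m _ hθ z => norm_rlamZ_le L hL1 (hV1 j hj.le) hθ _)
    B hb hB (logCovIterZ L U₀ B) (linCovIterZ L U₀ B) rfl
    (fun j _ => funext fun z => funext fun κ => logCovIterZ_succ L U₀ B j z κ) rfl
    (fun j _ => funext fun z => funext fun κ => by
      show linCovIterZ L U₀ B (j + 1) z κ = QhatZ L (V j) (linCovIterZ L U₀ B j) ((L : ℤ) • z) κ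
        + dcovF (V (j + 1)) (fun w => lamZ L (V j) (linCovIterZ L U₀ B j) ((L : ℤ) • w)) z κ
      rw [linCovIterZ_succ, hV, dcovF_succ_eq_dcovZ, ← linQcovZ_eq_QhatZ_add_dcovZ])
    hP (by rw [KZ] at hsmall; exact hsmall) (fun j hj => by rw [KZ] at hc₃; exact hc₃ j hj)
  -- read off, bounding the partial products by the k-uniform constant
  intro j hj
  obtain ⟨hY, hE, hX⟩ := hind j hj
  have hPj : ∏ i ∈ range j, (1 + κf i) ≤ Real.exp (4 * cZ d * α₀) := (prod_one_add_mono κf hκ0 hj).trans hP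
  have hg1 : 0 ≤ 1 + 2 * gZ d L := by have := gZ_nonneg d L; positivity
  have ht0 : 0 ≤ (L : ℝ) ^ j * b := by positivity
  refine ⟨fun z κ => (hY z κ).trans ?_, fun z κ => (hE z κ).trans ?_, fun z κ => by rw [KZ]; exact hX z κ⟩
  · have := mul_le_mul_of_nonneg_left hPj hg1
    exact mul_le_mul_of_nonneg_right this ht0
  · have h2 : 0 ≤ (1 + 2 * gZ d L) * (2 * C₁ * (2 * (1 + 2 * gZ d L)) ^ 2) := by positivity
    rw [KZ]
    exact mul_le_mul_of_nonneg_right (mul_le_mul_of_nonneg_left hPj h2) (sq_nonneg _)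

end Prop4

end Literature.MathematicalPhysics.QuantumFieldTheory.Balaban1983to89.B7Prop4GeneralLevelsRec
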